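import Summits.NavierStokesRegularity.NavierStokesRegularity.Theorems.FilamentSkeletonRssKelvinGateAccretionMode
import Summits.NavierStokesRegularity.NavierStokesRegularity.Theorems.FilamentSkeletonRssKelvinGateSmoothing
import HarnessLib

/-!
# Route `FilamentSkeletonRss` · crux `TransverseReductionRJ` (stmt-NavierStokesRegularity-21221) — line
# `kelvin_gate`: stub S4 `EllipticSmoothing` PROVED

HONEST FRAMING. Bookkeeping for a HYPOTHETICAL filament-type RSS blow-up route; nothing here bears
on Navier–Stokes regularity. This file proves the registered stub S4 of the line
(`stub_ellipticSmoothing : EllipticSmoothing`, statement = the `def` of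
`FilamentSkeletonRssKelvinGateDefs`, by name): a `C²` divergence-free velocity with `C¹` pressure
solving the rotated forced profile system with accretion-mode forcing `Σⱼ Bⱼ D_pj` is `C^∞`, and so
is the pressure. Proof: the accretion modes are smooth (`KelvinGate.DefD.contDiff`, clause 3 of
the box gives the unit tangent), so the `H^s_loc` ladder of `…KelvinGateSmoothing`
(`Smoothing.contDiff_velocity_infty`, `Smoothing.contDiff_pressure_infty`) applies with
`F = Σⱼ Bⱼ D_pj`. Stubs S1–S3 of the line are untouched; no summit is proved.
-/

set_option linter.dupNamespace false

noncomputable section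

namespace Summit.NavierStokesRegularity.NavierStokesRegularity.Theorems.KelvinGate

open Set Function
open Literature.Analysis.FluidPDE
open scoped ContDiff

/-- **Stub S4 `EllipticSmoothing` of line `kelvin_gate`** (crux `TransverseReductionRJ`,
stmt-NavierStokesRegularity-21221): interior regularity for the rotated forced Leray profile
system with accretion-mode forcing — `U ∈ C²`, `P ∈ C¹` ⇒ `U, P ∈ C^∞`. [cite: Tsai1998, p. 33] -/
theorem stub_ellipticSmoothing : EllipticSmoothing := by
  intro N Γ δ ρ K Λ a b cnd Rw Rb cg θ₀ γ α X w c m n u v A T D hD hbox p hp U P B hU hP hdiv heq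
  have hunit : ∀ j, ‖deriv (X p j) (c p j)‖ = 1 := fun j => ((hbox.2 p hp).2.2.1 j).2.2.1 (c p j)
  have hF : ContDiff ℝ ∞ fun y : EuclideanSpace ℝ (Fin 3) => ∑ j, B j • D p j y :=
    ContDiff.sum fun j _ => (hD.contDiff p j (hunit j)).const_smul (B j)
  exact ⟨Smoothing.contDiff_velocity_infty (F := fun y => ∑ j, B j • D p j y) hU hdiv hP hF heq,
    Smoothing.contDiff_pressure_infty (F := fun y => ∑ j, B j • D p j y) hU hdiv hP hF heq⟩

end Summit.NavierStokesRegularity.NavierStokesRegularity.Theorems.KelvinGate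

end
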